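import Mathlib.Combinatorics.Nullstellensatz
import Literature.Computability.AlgebraicComplexity.MS21ContinuantHittingSetProofs
import HarnessLib

/-!
# Medini–Shpilka 2021: the uniform SV generator of independence `k`, generators give hitting
# sets, and Cor 44 (hitting sets for orbits of sparse polynomials) from Thm 43

Theorem-only companion of `Literature/Computability/AlgebraicComplexity/MS21DenseOrbitsHittingSets.lean`
(cell `val-lit`, seat t21; the source is D. Medini, A. Shpilka, *Hitting sets and reconstruction
for dense orbits in VP_e and ΣΠΣ circuits*, CCC 2021 = arXiv:2102.05632 [MediniShpilka2021]; CCC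
numbering for the §1 statements as fixed by the crosswalk in that file's module docstring, arXiv
numbering `3.x` for §3, whose held text is `paper:arxiv-2102.05632` p0017). It supplies the two
generic ingredients by which every "for any `k`-independent map `G`, `f ∘ G ≠ 0`" theorem of the
source becomes a hitting SET of the printed size, and uses them to reduce the named fact
`MS2021_cor_44` to the named fact `MS2021_thm_43` BY NAME:

* **arXiv Obs 1.14 (= CCC Obs 18), "generators immediately give rise to hitting sets"**: "Let
  `G : F^k → F^n` be a generator for `𝒞` such that the individual degree of each coordinate of `G`
  is at most `r`. Let `W ⊂ F` be any set of size `|W| = d·r + 1`. Let `H = G(W^k)`. Then `H` hits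
  every `n`-variate polynomial `f ∈ 𝒞` of degree at most `d`." — `isHittingSetFor_image_piFinset`
  (the individual degrees of `f ∘ G` are at most `d·r`, the tree's `MS2021.degreeOf_bind₁_le` of
  `MS21ContinuantHittingSetProofs.lean` (seat x6, Cor 29, the case `k = 1`); a nonzero polynomial
  of individual degrees `< |W|` does not vanish on `W^k`, Mathlib's
  `MvPolynomial.eq_zero_of_eval_zero_at_prod_finset`), with `|H| ≤ |W|^k`
  (`card_image_piFinset_le`).
* **arXiv Def 3.2 / Def 3.4 / Obs 3.3 / Obs 3.5, the (uniform) SV generator of independence `k`**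
  ([Shpilka–Volkovich]; "`Ĝ_k(y_1, …, y_{2k}, z_1, …, z_k) = (Σ_j y_{j+k}^{n-1} L_i(y_j / y_{j+k}) · z_j)_i`
  … is a uniform `k`-independent polynomial map, with individual degrees at most `n - 1`"): for `n`
  distinct field elements `α_1, …, α_n` the homogenised Lagrange polynomial is written directly as
  the product of linear forms `c_i · ∏_{m ≠ i} (y_1 - α_m y_2)`, `c_i = (∏_{m ≠ i} (α_i - α_m))⁻¹`,
  so block `l` of the map is `(c_i ∏_{m ≠ i} (y_{l,1} - α_m y_{l,2}) · z_l)_i` on the variables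
  `Fin k × (Fin 2 ⊕ Unit)` of `MS2021.IsIndependent` — `exists_uniformSV`: `IsIndependent k`, every
  coordinate homogeneous of degree `n` (so `IsUniform`), individual degrees `≤ n`, and the explicit
  formula. The `n` distinct elements exist in any field with `|F| ≥ n` or infinite
  (`exists_finset_card_eq`, `exists_embedding_of_card_le`).
* **Cor 44 from Thm 43** ("(cor:hs-sparse) follows immediately from (thm:PITSINV) and
  (obsHitSetGen)", arXiv p0035:L5): `MS2021_cor_44_of_thm_43 : MS2021_thm_43 → MS2021_cor_44` with
  the explicit constant `c = 12`: for `|F| > n·d` take `W` of size `n·d + 1`, `t = ⌊log₂ s⌋ + 1` (so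
  `s ≤ 2^t`), the uniform SV generator of independence `t + 1` (a generator for the orbits of
  `s`-sparse polynomials of degree `≤ d` by Thm 43), and `H = G(W^{3(t+1)})`,
  `|H| ≤ (nd + 1)^{3(t+1)} ≤ (nd)^{12(⌊log₂ s⌋ + 1)}` once `nd ≥ 2`; the rows `d = 0`, `n = 0` and
  `n = d = 1` use the identity map as generator and the grids `{0}^n`, `{0,1}` (`|H| ≤ 2`).
  `MS2021_thm_43` itself is NOT proved here (a separate discharge); nothing is assumed about it
  beyond its typed statement.

No definition, no new named fact (D-0026); no `instance`, no `notation`. HONEST FRAMING: literature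
hygiene — a typed corollary reduced to a typed theorem of the same paper; `VP ≠ VNP` is NOT proved
and nothing here bears on it.

## References
* [MediniShpilka2021] D. Medini, A. Shpilka, CCC 2021, LIPIcs 200:19 = arXiv:2102.05632: Obs 18
  (= arXiv Obs 1.14, held text p0006.txt:L53-58), Def 19 (= arXiv Def 1.15), §3 Def 3.2, Obs 3.3,
  Def 3.4, Obs 3.5 (arXiv numbering, p0017.txt:L14-42), Thm 43 (= arXiv ‹PITSINV›), Cor 44 (= arXiv
  ‹Cor 1.27›, p0009.txt:L4-5; proof sentence p0035.txt:L5).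
* A. Shpilka, I. Volkovich, *Read-once polynomial identity testing*, Comput. Complexity 24 (2015)
  (the generator `G_k`; cited through [MediniShpilka2021, Def 3.2]).
* N. Alon, *Combinatorial Nullstellensatz* (1999), Lemma (non-vanishing on grids) — Mathlib
  `MvPolynomial.eq_zero_of_eval_zero_at_prod_finset`.
-/

noncomputable section

open MvPolynomial

namespace Literature.Computability.AlgebraicComplexity

namespace MS2021

/-! ### Obs 18 (arXiv Obs 1.14): generators give hitting sets -/

section Generator

variable {K : Type*} [CommRing K] [IsDomain K] {n : ℕ} {τ : Type*}

/-- A nonzero polynomial whose individual degrees are `< |W|` does not vanish identically on the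
grid `W^τ` (Alon's Nullstellensatz, grid form; the step "at least one of the values in
`(f ∘ G)(W^k)` is not zero" of Obs 18). [cite: MediniShpilka2021, Obs 18 (= arXiv Obs 1.14, proof, p0006.txt:L57-58)] -/
theorem exists_eval_ne_zero_of_degreeOf_lt [Finite τ] (P : MvPolynomial τ K) (W : Finset K)
    (hdeg : ∀ v, degreeOf v P < W.card) (hP : P ≠ 0) :
    ∃ x : τ → K, (∀ v, x v ∈ W) ∧ eval x P ≠ 0 := by
  by_contra h
  simp only [not_exists, not_and, not_not] at h
  exact hP (eq_zero_of_eval_zero_at_prod_finset P (fun _ => W) hdeg fun x hx => h x hx)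

/-- **MS Obs 18 (arXiv Obs 1.14): generators give hitting sets.** "Let `G : F^k → F^n` be a
generator for `𝒞(F)` such that the individual degree of each coordinate of `G` is at most `r`. Let
`W ⊂ F` be any set of size `|W| = d·r + 1` [here: any `|W| > d·r`]. Let `H = G(W^k)`. Then `H` hits
every `n`-variate polynomial `f ∈ 𝒞` of degree at most `d`." (The class is assumed to consist of
polynomials of degree `≤ d`; seed variables `τ`, `H = ` the image of the grid `W^τ` under
evaluation of `G`.) [cite: MediniShpilka2021, Obs 18 (CCC p.19:8; = arXiv Obs 1.14, p0006.txt:L53-58)] -/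
theorem isHittingSetFor_image_piFinset [Fintype τ] [DecidableEq τ] [DecidableEq K]
    {𝒞 : Set (MvPolynomial (Fin n) K)} {G : Fin n → MvPolynomial τ K}
    (hgen : HittingSets.IsGeneratorFor G 𝒞) {D r : ℕ} (hdeg : ∀ f ∈ 𝒞, f.totalDegree ≤ D)
    (hG : ∀ j v, degreeOf v (G j) ≤ r) (W : Finset K) (hW : D * r < W.card) :
    HittingSets.IsHittingSetFor
      (↑((Fintype.piFinset fun _ : τ => W).image fun (x : τ → K) (j : Fin n) => eval x (G j)) :
        Set (Fin n → K)) 𝒞 := by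
  intro f hf hf0
  obtain ⟨x, hxW, hx⟩ := exists_eval_ne_zero_of_degreeOf_lt (bind₁ G f) W
    (fun v => ((degreeOf_bind₁_le G v (fun j => hG j v) f).trans
      (Nat.mul_le_mul_right _ (hdeg f hf))).trans_lt hW) (hgen f hf hf0)
  refine ⟨fun j => eval x (G j), ?_, ?_⟩
  · rw [Finset.coe_image]
    exact Set.mem_image_of_mem _ (Finset.mem_coe.2 (Fintype.mem_piFinset.2 hxW))
  · simpa only [MvPolynomial.eval, eval₂Hom_bind₁] using hx

omit [IsDomain K] in
/-- The hitting set of Obs 18 has at most `|W|^k` points (`k` = number of seed variables).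
[cite: MediniShpilka2021, Obs 18 (= arXiv Obs 1.14, "`H = G(W^k)`", p0006.txt:L54)] -/
theorem card_image_piFinset_le [Fintype τ] [DecidableEq τ] [DecidableEq K]
    (G : Fin n → MvPolynomial τ K) (W : Finset K) :
    ((Fintype.piFinset fun _ : τ => W).image fun (x : τ → K) (j : Fin n) => eval x (G j)).card ≤
      W.card ^ Fintype.card τ :=
  Finset.card_image_le.trans (by rw [Fintype.card_piFinset, Finset.prod_const, Finset.card_univ])

omit [IsDomain K] in
/-- The identity map `x ↦ x` is (trivially) a generator for every class: `f ∘ id = f`.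
[cite: MediniShpilka2021, Def 17 (= arXiv Def 1.13, p0006.txt:L47)] -/
theorem isGeneratorFor_X (𝒞 : Set (MvPolynomial (Fin n) K)) :
    HittingSets.IsGeneratorFor (fun j => (X j : MvPolynomial (Fin n) K)) 𝒞 := by
  intro f _ hf0
  show bind₁ X f ≠ 0
  rwa [bind₁_X_left, AlgHom.id_apply]

/-- Grid form of Obs 18 with one finite set `S_v` per seed variable: a nonzero polynomial with
`deg_v P < |S_v|` for every `v` does not vanish on `∏_v S_v`.
[cite: MediniShpilka2021, Obs 18 (= arXiv Obs 1.14, proof, p0006.txt:L57-58)] -/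
theorem exists_eval_ne_zero_of_degreeOf_lt_card [Finite τ] (P : MvPolynomial τ K)
    (S : τ → Finset K) (hdeg : ∀ v, degreeOf v P < (S v).card) (hP : P ≠ 0) :
    ∃ x : τ → K, (∀ v, x v ∈ S v) ∧ eval x P ≠ 0 := by
  by_contra h
  simp only [not_exists, not_and, not_not] at h
  exact hP (eq_zero_of_eval_zero_at_prod_finset P S hdeg fun x hx => h x hx)

/-- **MS Obs 18 (arXiv Obs 1.14), per-variable grids.** If `G` is a generator for `𝒞` and, for
every `f ∈ 𝒞`, the individual degree of `f ∘ G` in the seed variable `v` is `< |S_v|`, then the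
image of the grid `∏_v S_v` under `G` hits `𝒞` (the form used when the control variables and the
`z`-variables of an independent map get grids of different sizes, as for Cor 29 / Cor 34).
[cite: MediniShpilka2021, Obs 18 (CCC p.19:8; = arXiv Obs 1.14, p0006.txt:L53-58)] -/
theorem isHittingSetFor_image_piFinset_of_degreeOf_lt [Fintype τ] [DecidableEq τ] [DecidableEq K]
    {𝒞 : Set (MvPolynomial (Fin n) K)} {G : Fin n → MvPolynomial τ K}
    (hgen : HittingSets.IsGeneratorFor G 𝒞) (S : τ → Finset K)
    (hdeg : ∀ f ∈ 𝒞, ∀ v, degreeOf v (bind₁ G f) < (S v).card) :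
    HittingSets.IsHittingSetFor
      (↑((Fintype.piFinset S).image fun (x : τ → K) (j : Fin n) => eval x (G j)) :
        Set (Fin n → K)) 𝒞 := by
  intro f hf hf0
  obtain ⟨x, hxS, hx⟩ :=
    exists_eval_ne_zero_of_degreeOf_lt_card (bind₁ G f) S (hdeg f hf) (hgen f hf hf0)
  refine ⟨fun j => eval x (G j), ?_, ?_⟩
  · rw [Finset.coe_image]
    exact Set.mem_image_of_mem _ (Finset.mem_coe.2 (Fintype.mem_piFinset.2 hxS))
  · simpa only [MvPolynomial.eval, eval₂Hom_bind₁] using hx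

omit [IsDomain K] in
/-- The per-variable-grid hitting set has at most `∏_v |S_v|` points.
[cite: MediniShpilka2021, Obs 18 (= arXiv Obs 1.14, "`H = G(W^k)`", p0006.txt:L54)] -/
theorem card_image_piFinset_le_prod [Fintype τ] [DecidableEq τ] [DecidableEq K]
    (G : Fin n → MvPolynomial τ K) (S : τ → Finset K) :
    ((Fintype.piFinset S).image fun (x : τ → K) (j : Fin n) => eval x (G j)).card ≤
      ∏ v, (S v).card :=
  Finset.card_image_le.trans (Fintype.card_piFinset S).le

end Generator

/-! ### Field elements: a finset of prescribed size, `n` distinct elements -/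

section Elements

variable {K : Type*} {n : ℕ}

/-- A field that is infinite or has at least `N` elements contains `N` distinct elements (the size
hypotheses "`|F| ≥ n²`", "`|F| > n·d`" of Cor 29 / Thm 30 / Cor 34 / Cor 44 are consumed in this
form). [cite: MediniShpilka2021, Def 3.2 footnote ("If `|F| < n` then we take these elements from an appropriate extension field"), arXiv p0017.txt:L16] -/
theorem exists_finset_card_eq (N : ℕ) (hK : Infinite K ∨ N ≤ Nat.card K) :
    ∃ W : Finset K, W.card = N := by
  cases finite_or_infinite K with
  | inr _ => exact Infinite.exists_subset_card_eq K N
  | inl _ =>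
    rcases hK with hinf | hle
    · exact Infinite.exists_subset_card_eq K N
    · haveI := Fintype.ofFinite K
      rw [Nat.card_eq_fintype_card, ← Finset.card_univ] at hle
      obtain ⟨t, -, ht⟩ := Finset.exists_subset_card_eq hle
      exact ⟨t, ht⟩

/-- `n` distinct elements `α_1, …, α_n` ("Fix `n` and a set of `n` distinct field elements
`𝒜 = {α_1, …, α_n} ⊆ F`", Def 3.2) chosen inside a finset with at least `n` elements.
[cite: MediniShpilka2021, Def 3.2 (arXiv p0017.txt:L16-17)] -/
theorem exists_embedding_of_card_le (W : Finset K) (h : n ≤ W.card) :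
    ∃ α : Fin n ↪ K, ∀ i, α i ∈ W := by
  obtain ⟨t, htW, htc⟩ := Finset.exists_subset_card_eq h
  refine ⟨(finCongr htc.symm).toEmbedding.trans
      (t.equivFin.symm.toEmbedding.trans (Function.Embedding.subtype _)), fun i => htW ?_⟩
  exact Finset.coe_mem _

end Elements

/-! ### Def 3.4 / Obs 3.5: the uniform SV generator of independence `k` -/

section SVGen

variable {K : Type*} [Field K] {n : ℕ}

/-- The homogenised Lagrange numerator `∏_{m ≠ i} (y_1 - α_m y_2)` evaluated at
`(y_1, y_2) = (α_{i₀}, 1)` is `∏_{m ≠ i} (α_{i₀} - α_m)`: `= c_i⁻¹ ≠ 0` for `i = i₀` and `= 0` for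
`i ≠ i₀` ("`L_i(α_j) = δ_{i,j}`", Def 3.2). [cite: MediniShpilka2021, Def 3.2 (arXiv p0017.txt:L16-17)] -/
theorem prod_erase_sub_eq_zero_of_ne (α : Fin n ↪ K) {i i₀ : Fin n} (h : i ≠ i₀) :
    ∏ m ∈ Finset.univ.erase i, (α i₀ - α m) = 0 :=
  Finset.prod_eq_zero (Finset.mem_erase.2 ⟨h.symm, Finset.mem_univ _⟩) (sub_self _)

/-- `∏_{m ≠ i} (α_i - α_m) ≠ 0` for distinct `α`'s (the Lagrange denominator).
[cite: MediniShpilka2021, Def 3.2 (arXiv p0017.txt:L16-17)] -/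
theorem prod_erase_sub_ne_zero (α : Fin n ↪ K) (i : Fin n) :
    ∏ m ∈ Finset.univ.erase i, (α i - α m) ≠ 0 :=
  Finset.prod_ne_zero_iff.2 fun _ hm =>
    sub_ne_zero.2 fun h => (Finset.mem_erase.1 hm).1 (α.injective h).symm

/-- **The uniform SV generator of independence `k` (Def 3.4 / Obs 3.5; Def 3.2 / Obs 3.3 for the
non-uniform version it homogenises).** Given `n` distinct field elements `α_1, …, α_n`, the map
`Ĝ_k : F^{3k} → F^n` whose `i`-th coordinate is
`Σ_{l=1}^{k} c_i · ∏_{m ≠ i} (y_{l,1} - α_m · y_{l,2}) · z_l`, `c_i = (∏_{m ≠ i} (α_i - α_m))⁻¹` — block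
`l` is `y_{l,2}^{n-1} L_i(y_{l,1}/y_{l,2}) · z_l` with `L_i` the `i`-th Lagrange interpolation
polynomial of `{α_1, …, α_n}` — "is a uniform `k`-independent polynomial map, with individual
degrees at most `n - 1`" [here: every coordinate is homogeneous of degree `n`, individual degrees
`≤ n`]. Variables `Fin k × (Fin 2 ⊕ Unit)`: `(l, inl 0) = y_{l,1}`, `(l, inl 1) = y_{l,2}`,
`(l, inr ()) = z_l`; independence (Def 19) is witnessed by the assignment
`(y_{l,1}, y_{l,2}) = (α_{i₀}, 1)`, under which block `l` becomes `(0, …, 0, z_l, 0, …, 0)`.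
[cite: MediniShpilka2021, Def 3.2, Obs 3.3, Def 3.4, Obs 3.5 (arXiv p0017.txt:L14-42); Def 19 (CCC p.19:9)] -/
theorem exists_uniformSV (α : Fin n ↪ K) (k : ℕ) :
    ∃ G : Fin n → MvPolynomial (Fin k × (Fin 2 ⊕ Unit)) K,
      IsIndependent k G ∧ (∀ i, (G i).IsHomogeneous n) ∧ (∀ i v, degreeOf v (G i) ≤ n) ∧
      ∀ i, G i = ∑ l : Fin k,
        (C (∏ m ∈ Finset.univ.erase i, (α i - α m))⁻¹ *
          ∏ m ∈ Finset.univ.erase i, (X (l, Sum.inl 0) - C (α m) * X (l, Sum.inl 1))) *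
          X (l, Sum.inr ()) := by
  classical
  -- one block, on the variables `Fin 2 ⊕ Unit`
  let B : Fin n → MvPolynomial (Fin 2 ⊕ Unit) K := fun i =>
    (C (∏ m ∈ Finset.univ.erase i, (α i - α m))⁻¹ *
      ∏ m ∈ Finset.univ.erase i, (X (Sum.inl 0) - C (α m) * X (Sum.inl 1))) * X (Sum.inr ())
  have hB : ∀ (l : Fin k) (i : Fin n), rename (Prod.mk l) (B i) =
      (C (∏ m ∈ Finset.univ.erase i, (α i - α m))⁻¹ *
        ∏ m ∈ Finset.univ.erase i, (X (l, Sum.inl 0) - C (α m) * X (l, Sum.inl 1))) *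
        X (l, Sum.inr ()) := by
    intro l i
    simp only [B, map_mul, map_prod, map_sub, rename_C, rename_X]
  -- independence of one block (Def 19)
  have hBind : IsOneIndependent B := by
    intro i₀
    refine ⟨![α i₀, 1], fun i => ?_⟩
    have hval : aeval (Sum.elim (fun s => C (![α i₀, 1] s)) (fun _ => X ()) :
        Fin 2 ⊕ Unit → MvPolynomial Unit K) (B i) =
        C ((∏ m ∈ Finset.univ.erase i, (α i - α m))⁻¹ *
          ∏ m ∈ Finset.univ.erase i, (α i₀ - α m)) * X () := by
      -- both sides normalise to `C c⁻¹ * ∏ (C α_{i₀} - C α_m) * X ()`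
      simp only [B, map_mul, map_prod, map_sub, aeval_C, aeval_X, Sum.elim_inl, Sum.elim_inr,
        Matrix.cons_val_zero, Matrix.cons_val_one, algebraMap_eq, map_one, mul_one]
    rw [hval]
    by_cases hi : i = i₀
    · subst hi
      rw [if_pos rfl, inv_mul_cancel₀ (prod_erase_sub_ne_zero α i), C_1, one_mul]
    · rw [if_neg hi, prod_erase_sub_eq_zero_of_ne α hi, mul_zero, C_0, zero_mul]
  -- homogeneity of one renamed block
  have hhom : ∀ (l : Fin k) (i : Fin n), (rename (Prod.mk l) (B i)).IsHomogeneous n := by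
    intro l i
    rw [hB]
    have hlin : ∀ m ∈ Finset.univ.erase i,
        (X (l, Sum.inl 0) - C (α m) * X (l, Sum.inl 1) :
          MvPolynomial (Fin k × (Fin 2 ⊕ Unit)) K).IsHomogeneous 1 := fun m _ =>
      (isHomogeneous_X K _).sub (by simpa using (isHomogeneous_C _ (α m)).mul (isHomogeneous_X K (l, Sum.inl 1)))
    have hprod := IsHomogeneous.prod (Finset.univ.erase i) _ (fun _ => 1) hlin
    have hcard : ∑ m ∈ Finset.univ.erase i, (1 : ℕ) = n - 1 := by
      rw [Finset.sum_const, smul_eq_mul, mul_one, Finset.card_erase_of_mem (Finset.mem_univ i),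
        Finset.card_univ, Fintype.card_fin]
    rw [hcard] at hprod
    have h := ((isHomogeneous_C _ ((∏ m ∈ Finset.univ.erase i, (α i - α m))⁻¹)).mul hprod).mul
      (isHomogeneous_X K (l, Sum.inr ()))
    have hn : 0 + (n - 1) + 1 = n := by have := i.pos; omega
    rwa [hn] at h
  refine ⟨fun i => ∑ l : Fin k, rename (Prod.mk l) (B i), ⟨fun _ => B, fun _ => hBind, fun i => rfl⟩,
    fun i => IsHomogeneous.sum _ _ n fun l _ => hhom l i, fun i v => ?_, fun i => ?_⟩
  · exact (degreeOf_le_totalDegree _ _).trans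
      (IsHomogeneous.sum _ _ n fun l _ => hhom l i).totalDegree_le
  · exact Finset.sum_congr rfl fun l _ => hB l i

/-- Every coordinate of the uniform SV generator being homogeneous of degree `n`, the map is
UNIFORM (Def 19). [cite: MediniShpilka2021, Obs 3.5 (arXiv p0017.txt:L42)] -/
theorem isUniform_of_forall_isHomogeneous {σ : Type*} {G : Fin n → MvPolynomial σ K} {e : ℕ}
    (h : ∀ i, (G i).IsHomogeneous e) : IsUniform G :=
  ⟨e, h⟩

/-- Existence form: over a field with at least `n` elements (or infinite) there is, for every `k`,
a uniform `k`-independent polynomial map into `F^n` on `3k` variables with individual degrees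
`≤ n` (Obs 3.5). [cite: MediniShpilka2021, Def 3.4 and Obs 3.5 (arXiv p0017.txt:L31-42)] -/
theorem exists_isIndependent_isUniform (K : Type*) [Field K] (n k : ℕ)
    (hK : Infinite K ∨ n ≤ Nat.card K) :
    ∃ G : Fin n → MvPolynomial (Fin k × (Fin 2 ⊕ Unit)) K,
      IsIndependent k G ∧ IsUniform G ∧ (∀ i, (G i).IsHomogeneous n) ∧
        ∀ i v, degreeOf v (G i) ≤ n := by
  obtain ⟨W, hW⟩ := exists_finset_card_eq (K := K) n hK
  obtain ⟨α, -⟩ := exists_embedding_of_card_le W hW.ge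
  obtain ⟨G, hind, hhom, hdeg, -⟩ := exists_uniformSV α k
  exact ⟨G, hind, isUniform_of_forall_isHomogeneous hhom, hhom, hdeg⟩

/-- A linear form `y - α y'` (or any `X p - C a * X q`) has individual degree `≤ 1` in every
variable, and `0` in a variable different from `p` and `q`. [cite: MediniShpilka2021, Obs 3.5 ("individual degrees at most `n - 1`", arXiv p0017.txt:L42)] -/
theorem degreeOf_X_sub_C_mul_X_le {σ : Type*} [DecidableEq σ] (v p q : σ) (a : K) :
    degreeOf v (X p - C a * X q : MvPolynomial σ K) ≤ 1 := by
  refine (degreeOf_sub_le _ _ _).trans (max_le ?_ ((degreeOf_C_mul_le _ _ _).trans ?_))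
  · rw [degreeOf_X]; split_ifs <;> simp
  · rw [degreeOf_X]; split_ifs <;> simp

/-- See `degreeOf_X_sub_C_mul_X_le`: degree `0` in a third variable.
[cite: MediniShpilka2021, Obs 3.5 (arXiv p0017.txt:L42)] -/
theorem degreeOf_X_sub_C_mul_X_eq_zero {σ : Type*} [DecidableEq σ] {v p q : σ} (hp : v ≠ p)
    (hq : v ≠ q) (a : K) : degreeOf v (X p - C a * X q : MvPolynomial σ K) = 0 := by
  refine Nat.eq_zero_of_le_zero ((degreeOf_sub_le _ _ _).trans (max_le ?_
    ((degreeOf_C_mul_le _ _ _).trans ?_)))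
  · rw [degreeOf_X_of_ne hp]
  · rw [degreeOf_X_of_ne hq]

/-- **Obs 3.5, individual degrees in the control variables:** the `i`-th coordinate of the uniform
SV generator has degree `≤ n - 1` in each `y_{l,1}`, `y_{l,2}` ("individual degrees at most
`n - 1`"). [cite: MediniShpilka2021, Obs 3.5 (arXiv p0017.txt:L42)] -/
theorem degreeOf_inl_uniformSV_le (α : Fin n ↪ K) (k : ℕ) (i : Fin n) (l : Fin k) (a : Fin 2) :
    degreeOf (l, Sum.inl a) (∑ l' : Fin k,
        (C (∏ m ∈ Finset.univ.erase i, (α i - α m))⁻¹ *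
          ∏ m ∈ Finset.univ.erase i, (X (l', Sum.inl 0) - C (α m) * X (l', Sum.inl 1))) *
          X (l', Sum.inr ()) : MvPolynomial (Fin k × (Fin 2 ⊕ Unit)) K) ≤ n - 1 := by
  classical
  refine (degreeOf_sum_le _ _ _).trans (Finset.sup_le fun l' _ => ?_)
  refine (degreeOf_mul_le _ _ _).trans ?_
  rw [degreeOf_X_of_ne (show ((l, Sum.inl a) : Fin k × (Fin 2 ⊕ Unit)) ≠ (l', Sum.inr ()) by simp),
    add_zero]
  refine (degreeOf_C_mul_le _ _ _).trans ((degreeOf_prod_le _ _ _).trans ?_)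
  calc ∑ m ∈ Finset.univ.erase i, degreeOf (l, Sum.inl a)
        (X (l', Sum.inl 0) - C (α m) * X (l', Sum.inl 1) : MvPolynomial (Fin k × (Fin 2 ⊕ Unit)) K)
      ≤ ∑ m ∈ Finset.univ.erase i, 1 :=
        Finset.sum_le_sum fun m _ => degreeOf_X_sub_C_mul_X_le _ _ _ _
    _ = n - 1 := by
      rw [Finset.sum_const, smul_eq_mul, mul_one, Finset.card_erase_of_mem (Finset.mem_univ i),
        Finset.card_univ, Fintype.card_fin]

/-- **Obs 3.5, individual degrees in the `z`-variables:** the `i`-th coordinate of the uniform SV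
generator is linear in each `z_l`. [cite: MediniShpilka2021, Def 3.4 / Obs 3.5 (arXiv p0017.txt:L31-42)] -/
theorem degreeOf_inr_uniformSV_le (α : Fin n ↪ K) (k : ℕ) (i : Fin n) (l : Fin k) :
    degreeOf (l, Sum.inr ()) (∑ l' : Fin k,
        (C (∏ m ∈ Finset.univ.erase i, (α i - α m))⁻¹ *
          ∏ m ∈ Finset.univ.erase i, (X (l', Sum.inl 0) - C (α m) * X (l', Sum.inl 1))) *
          X (l', Sum.inr ()) : MvPolynomial (Fin k × (Fin 2 ⊕ Unit)) K) ≤ 1 := by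
  classical
  refine (degreeOf_sum_le _ _ _).trans (Finset.sup_le fun l' _ => ?_)
  refine (degreeOf_mul_le _ _ _).trans ?_
  have h0 : degreeOf (l, Sum.inr ()) (C (∏ m ∈ Finset.univ.erase i, (α i - α m))⁻¹ *
      ∏ m ∈ Finset.univ.erase i, (X (l', Sum.inl 0) - C (α m) * X (l', Sum.inl 1)) :
        MvPolynomial (Fin k × (Fin 2 ⊕ Unit)) K) = 0 := by
    refine Nat.eq_zero_of_le_zero ((degreeOf_C_mul_le _ _ _).trans
      ((degreeOf_prod_le _ _ _).trans (Finset.sum_nonpos fun m _ => ?_)))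
    rw [degreeOf_X_sub_C_mul_X_eq_zero (by simp) (by simp)]
  rw [h0, zero_add, degreeOf_X]
  split_ifs <;> simp

end SVGen

/-! ### The orbits of sparse polynomials: degree bound and Thm 43 as a generator statement -/

section Sparse

variable {K : Type*} [Field K] {m n : ℕ}

/-- `affSubst` of the zero polynomial is zero. [cite: MediniShpilka2021, §1.1.6 eq. (2)] -/
theorem affSubst_zero (h : m ≤ n) (A : Matrix (Fin n) (Fin n) K) (b : Fin n → K) :
    affSubst h A b 0 = 0 := by
  unfold affSubst
  exact map_zero _

/-- Members of `(Σ^{[s]}Π^{[d]})^{GLaff_n}` have degree `≤ d` (affine substitutions do not raise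
the degree). [cite: MediniShpilka2021, Def 3 and Cor 44 (CCC p.19:6, 19:14)] -/
theorem totalDegree_le_of_mem_sparseAffOrbits {s d : ℕ} {f : MvPolynomial (Fin n) K}
    (hf : f ∈ sparseAffOrbits (K := K) n s d) : f.totalDegree ≤ d := by
  obtain ⟨m, g, -, hgd, h, A, b, -, rfl⟩ := hf
  exact (totalDegree_affSubst_le h A b g).trans hgd

end Sparse

end MS2021

/-! ### Cor 44 from Thm 43 -/

section Cor44

open MS2021 HittingSets

/-- **Thm 43 as a generator statement:** if `MS2021_thm_43` holds and `s ≤ 2^t`, every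
`(t+1)`-independent map is a generator (Def 17) for the orbits of `s`-sparse polynomials of degree
`≤ d` (a nonzero member `f = g(Ax+b)` has `g ≠ 0`).
[cite: MediniShpilka2021, Thm 43 and Cor 44 (CCC p.19:14); proof sentence arXiv p0035.txt:L5] -/
theorem MS2021.isGeneratorFor_sparseAffOrbits_of_thm_43 (h43 : MS2021_thm_43) {K : Type} [Field K]
    {n s d t c : ℕ} (hs : s ≤ 2 ^ t) {G : Fin n → MvPolynomial (Fin (t + 1) × (Fin c ⊕ Unit)) K}
    (hG : IsIndependent (t + 1) G) : IsGeneratorFor G (sparseAffOrbits (K := K) n s d) := by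
  intro f hf hf0
  obtain ⟨m, g, hgs, -, hfo⟩ := hf
  have hg0 : g ≠ 0 := by
    rintro rfl
    obtain ⟨h, A, b, -, rfl⟩ := hfo
    exact hf0 (affSubst_zero h A b)
  exact h43 K n m t c g hg0 (hgs.trans hs) f hfo G hG

/-- The numerical form of the size bound: `(x + 1)^{3(L+2)} ≤ x^{12(L+1)} + 12` for `x ≥ 2`
(`(x+1) ≤ x²`). [cite: MediniShpilka2021, Cor 44 ("`|H| = (nd)^{O(log s)}`", CCC p.19:14)] -/
theorem MS2021.cor44_size_bound {x L : ℕ} (hx : 2 ≤ x) :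
    (x + 1) ^ (3 * (L + 2)) ≤ x ^ (12 * (L + 1)) + 12 := by
  have h1 : x + 1 ≤ x ^ 2 := by nlinarith
  calc (x + 1) ^ (3 * (L + 2)) ≤ (x ^ 2) ^ (3 * (L + 2)) := Nat.pow_le_pow_left h1 _
    _ = x ^ (6 * (L + 2)) := by rw [← pow_mul]; ring_nf
    _ ≤ x ^ (12 * (L + 1)) := Nat.pow_le_pow_right (by omega) (by omega)
    _ ≤ x ^ (12 * (L + 1)) + 12 := Nat.le_add_right _ _

/-- **MS Cor 44 follows from MS Thm 43** ("(cor:hs-sparse) follows immediately from (thm:PITSINV)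
and (obsHitSetGen)"): with `c = 12`, over every field with `|F| > n·d` (or infinite) there is a set
of at most `(n·d)^{12(⌊log₂ s⌋ + 1)} + 12` points hitting every nonzero
`f ∈ (Σ^{[s]}Π^{[d]})^{GLaff_n(F)}` — the image of the grid `W^{3(t+1)}`, `|W| = n·d + 1`,
`t = ⌊log₂ s⌋ + 1`, under the uniform SV generator of independence `t + 1` (Obs 18 with the
individual-degree bound `r = n` and the degree bound `d`); the rows `d = 0`, `n = 0`, `n = d = 1`
use the identity generator with the grids `{0}^n`, `{0,1}`.
[cite: MediniShpilka2021, Cor 44 (CCC p.19:14; = arXiv ‹Cor 1.27› p0009.txt:L4-5; proof p0035.txt:L5)] -/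
theorem MS2021_cor_44_of_thm_43 (h43 : MS2021_thm_43) : MS2021_cor_44 := by
  classical
  refine ⟨12, fun K _ s d n hK => ?_⟩
  -- the three small rows, identity generator
  have small : ∀ (W : Finset K) (r : ℕ), (∀ (j : Fin n) (v : Fin n),
      degreeOf v (X j : MvPolynomial (Fin n) K) ≤ r) → d * r < W.card →
      W.card ^ n ≤ 12 →
      ∃ H : Finset (Fin n → K), H.card ≤ (n * d) ^ (12 * (Nat.log 2 s + 1)) + 12 ∧
        IsHittingSetFor (↑H) (sparseAffOrbits (K := K) n s d) := by
    intro W r hr hW hcard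
    refine ⟨(Fintype.piFinset fun _ : Fin n => W).image fun (x : Fin n → K) (j : Fin n) =>
        eval x (X j : MvPolynomial (Fin n) K), ?_,
      isHittingSetFor_image_piFinset (isGeneratorFor_X _) (D := d) (r := r)
        (fun f hf => totalDegree_le_of_mem_sparseAffOrbits hf) hr W hW⟩
    refine (card_image_piFinset_le _ W).trans ?_
    rw [Fintype.card_fin]
    exact hcard.trans (Nat.le_add_left _ _)
  rcases Nat.eq_zero_or_pos d with rfl | hd
  · -- `d = 0`: constants; the grid `{0}^n`
    refine small {0} 1 (fun j v => (degreeOf_le_totalDegree _ _).trans (totalDegree_X (R := K) j).le)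
      (by simp) ?_
    simp
  rcases Nat.eq_zero_or_pos n with rfl | hn
  · -- `n = 0`: the one-point grid
    exact small {0} 0 (fun j => j.elim0) (by simp) (by simp)
  by_cases hnd : n * d < 2
  · -- `n = d = 1`: the grid `{0, 1}`
    have hn1 : n = 1 := by nlinarith
    have hd1 : d = 1 := by nlinarith
    subst hn1; subst hd1
    refine small {0, 1} 1 (fun j v => (degreeOf_le_totalDegree _ _).trans (totalDegree_X (R := K) j).le)
      (by rw [Finset.card_pair (zero_ne_one' K)]; norm_num) ?_
    rw [Finset.card_pair (zero_ne_one' K)]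
    norm_num
  -- main row: `n d ≥ 2`
  replace hnd : 2 ≤ n * d := not_lt.1 hnd
  obtain ⟨W, hW⟩ : ∃ W : Finset K, W.card = n * d + 1 :=
    exists_finset_card_eq (K := K) (n * d + 1) (hK.imp id fun h => h)
  obtain ⟨α, -⟩ := exists_embedding_of_card_le W
    (show n ≤ W.card by rw [hW]; exact (Nat.le_mul_of_pos_right n hd).trans (Nat.le_succ _))
  set t := Nat.log 2 s + 1 with ht
  have hs : s ≤ 2 ^ t := (Nat.lt_pow_succ_log_self one_lt_two s).le
  obtain ⟨G, hGind, -, hGdeg, -⟩ := exists_uniformSV α (t + 1)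
  have hgen := MS2021.isGeneratorFor_sparseAffOrbits_of_thm_43 h43 (d := d) hs hGind
  refine ⟨(Fintype.piFinset fun _ : Fin (t + 1) × (Fin 2 ⊕ Unit) => W).image
      fun (x : Fin (t + 1) × (Fin 2 ⊕ Unit) → K) (j : Fin n) => eval x (G j), ?_,
    isHittingSetFor_image_piFinset hgen (D := d) (r := n)
      (fun f hf => totalDegree_le_of_mem_sparseAffOrbits hf) hGdeg W (by rw [hW]; nlinarith)⟩
  refine (card_image_piFinset_le _ W).trans ?_
  have hτ : Fintype.card (Fin (t + 1) × (Fin 2 ⊕ Unit)) = 3 * (Nat.log 2 s + 2) := by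
    simp only [Fintype.card_prod, Fintype.card_fin, Fintype.card_sum, Fintype.card_unit, ht]
    ring
  rw [hW, hτ]
  exact MS2021.cor44_size_bound hnd

end Cor44

end Literature.Computability.AlgebraicComplexity

end
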